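import Literature.LinearAlgebra.RootSystem.PositiveSystemsParabolic
import Literature.LinearAlgebra.RootSystem.WeylGroupPoincarePolynomial
import Mathlib.Tactic.TFAE
import HarnessLib

/-!
# Inversion sets `N(w) = {α ≻ 0 : wα ≺ 0}`: Kostant's characterisation (the subsets of `Φ⁺` closed with closed complement are the `N(w)`),
# `N(yx) = N(x) ⊔ x⁻¹N(y)` iff `ℓ(yx) = ℓ(y) + ℓ(x)` (Sommers–Tymoczko 2006, §4, Lemma 5.1, Corollary 5.2)

E. Sommers, J. Tymoczko, *Exponents for B-stable ideals*, Trans. AMS 358 (2006) (held: `paper:arxiv-math_0406047`, pp. 6–7): "Given `S ⊂ R` we say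
that `S` is `R`-closed if `α, β ∈ S` and `α + β ∈ R`, then `α + β ∈ S`. … if `w ∈ W`, then `N(w) := {α ∈ Φ⁺ | w(α) ≺ 0}` is `Φ⁺`-closed …
Conversely every subset of `Φ⁺` which is `Φ⁺`-closed [with `Φ⁺`-closed complement: 'both `S` and `S^c` are `𝓘^c`-closed', 'of Weyl-type'] is
equal to `N(w)` for a unique `w ∈ W`. This is well-known and goes back to [Kostant 1961]." §5: "**Lemma 5.1.** Let `x, y ∈ W`. Then the following
four conditions are equivalent: (i) `N(x) ⊆ N(yx)` (ii) `x⁻¹N(y) ⊆ Φ⁺` (iii) `N(yx) = N(x) ∪ x⁻¹N(y)` (iv) `l(yx) = l(y) + l(x)`. *Proof.* Certainly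
(iii) implies (ii) by definition. Then `N(x) ⊆ N(yx)` if and only if `x⁻¹N(y) ⊆ Φ⁺` since `α ∈ x⁻¹N(y)` with `α ≺ 0` if and only if `-α ∈ N(x)`
and `-α ∉ N(yx)`. … It is easy to check from the definitions that `N(yx) ⊆ N(x) ∪ x⁻¹N(y)` where the union is a disjoint union. Also
`l(yx) ≤ l(x) + l(y)` which implies that `|N(yx)| ≤ |N(x)| + |N(y)| = |N(x)| + |x⁻¹N(y)|`. Hence equality in [lengths] is equivalent to equality in
[containment], which shows that (iii) and (iv) are equivalent. Finally, it is clear that `x⁻¹N(y) ∩ Φ⁺ ⊆ N(yx)`, so if (i) holds so does (iii).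
**Corollary 5.2.** Given `x, w ∈ W`. If `N(x) ⊊ N(w)`, then there exists `α, β ∈ Π` so that `N(x) ⊊ N(s_α x) ⊆ N(w)` and
`N(x) ⊆ N(s_β w) ⊊ N(w)`."
B. Kostant, *Lie algebra cohomology and the generalized Borel–Weil theorem*, Ann. of Math. 74 (1961), Proposition 5.10 (cited through Sommers–Tymoczko;
not held).

THIS FILE (lane `lit-hodgefound`, prover seat p40, generation 41, row g41-#2; topic `Literature/LinearAlgebra/RootSystem`, namespace
`Literature.LinearAlgebra.RootSystem.Base`) proves these for a finite reduced crystallographic root pairing `P` over a field `K` of characteristic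
`0` with base `b` (`Φ⁺ = b.IsPos`), for the index action of `Aut P ⊇ W`: the inversion set of `w` is written `{α_k : α_k ≻ 0, wα_k ≺ 0}` =
`b.IsPos k ∧ ¬ b.IsPos (w • k)` (as in the tree's `WeylGroupPoincarePolynomial`, where `ℓ(w) = n(w) = #N(w)` for `w ∈ W` is
`length_weylGroup_eq_card_filter` of `WeylGroupCoxeterSystem`), `x⁻¹N(y)` is `{α_k : xα_k ≻ 0, yxα_k ≺ 0}`, and «closed» is the hypothesis
`α_m = α_k + α_l ⟹ …` on indices. Lemma 5.1 is proved for ARBITRARY automorphisms `x, y` of `P` with `ℓ` read as `n(·) = #N(·)` (for `x, y ∈ W`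
this is the length). No definition is introduced.

## What is proved (THEOREMS ONLY: no definition, no instance, no notation, no named fact; net debt 0)

* §1 ★ **`isPos_and_not_isPos_smul_of_root_eq_add`** (`N(w)` IS CLOSED), ★ **`isPos_and_isPos_smul_of_root_eq_add`** (`Φ⁺ ∖ N(w)` IS CLOSED) — for
  any automorphism `w`.
* §2 KOSTANT'S CONVERSE: ★★★ **`exists_weylGroup_forall_mem_iff_isPos_and_not_isPos_smul`** (A SUBSET `B ⊆ Φ⁺` SUCH THAT `B` AND `Φ⁺ ∖ B` ARE
  CLOSED IS `N(w)` FOR SOME `w ∈ W`: `(Φ⁺ ∖ B) ∪ (-B)` is closed with `Φ = Ψ ⊔ -Ψ`, hence a positive system `w⁻¹Φ⁺` by g40-#8), ★★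
  **`existsUnique_weylGroup_forall_mem_iff_isPos_and_not_isPos_smul`** (… FOR A UNIQUE `w ∈ W`, by g37 `eq_of_forall_isPos_smul_iff`).
* §3 SOMMERS–TYMOCZKO LEMMA 5.1 for automorphisms `x, y`: ★ **`isPos_and_not_isPos_mul_smul_imp`** (`N(yx) ⊆ N(x) ∪ x⁻¹N(y)`), ★★
  **`isPos_of_forall_not_isPos_mul_smul`** ((i) ⟹ (ii)), ★★ **`isPos_and_not_isPos_mul_smul_iff_of_forall_isPos`** ((ii) ⟹ (iii)), ★★
  **`card_filter_isPos_smul_and_not_isPos_smul_eq`** (`#x⁻¹N(y) = #N(y)`), ★★ **`card_filter_mul_le_add_aut`** (`n(yx) ≤ n(y) + n(x)`, any automorphisms; the `W`-version via Coxeter lengths is `card_filter_mul_le_add` of `WeylGroupSignCharacter`), ★★★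
  **`tfae_inversionSet_mul`** (LEMMA 5.1: (i) ⟺ (ii) ⟺ (iii) ⟺ (iv) as a `List.TFAE`), ★★ **`card_filter_mul_eq_add_iff`** ((iv) ⟺ (i) extracted).
* §4 ★★★ **`exists_mem_support_ssubset_of_ssubset`** ∕ ★★★ **`exists_mem_support_ssubset_of_ssubset'`** (COROLLARY 5.2: if `N(x) ⊊ N(w)` for
  `x, w ∈ W` there are simple `α, β` with `N(x) ⊊ N(s_α x) ⊆ N(w)` and `N(x) ⊆ N(s_β w) ⊊ N(w)`; here `s_α x` adds the single root `x⁻¹α`).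

BY NAME, nothing restated: g40-#8 `PositiveSystemsParabolic` (`exists_weylGroup_forall_smul_mem_iff_isPos`, `isPos_smul_of_root_eq_add`,
`isPos_smul_or_isPos_smul_neg`, `not_isPos_smul_neg_of_isPos_smul`), g37 `WeylGroupPoincarePolynomial` (`eq_of_forall_isPos_smul_iff`), g36
`WeylGroupSimpleReflections` (`smul_index_eq`, `reflection_smul_index`, `eq_one_of_forall_isPos_smul`), g32 `WeylVector` (`indexEquiv_neg`); Mathlib
(`Base.IsPos.add`, `IsPos.reflectionPerm`, `IsPos.neg_iff_not`, `Finset.card_bij'`, `Finset.card_union_of_disjoint`, `Finset.eq_of_subset_of_card_le`).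

## Scope caveats

Inversion sets are not introduced as a definition (they are the filters `{k | b.IsPos k ∧ ¬ b.IsPos (w • k)}` of the tree); `ℓ` in (iv) is the
cardinality `n(·)`, which is the Coxeter length on `W` by the tree's `length_weylGroup_eq_card_filter` (not re-imported here). Sommers–Tymoczko's
Lemma 5.3 (minimal coset representatives) is the tree's `ParabolicSubgroupCosetRepresentatives`; their §6 (subsets of Weyl type relative to an
ideal, Prop. 6.1) and the Poincaré polynomial Theorem 4.1 are not formalised here.
-/

open Module Set Function

namespace Literature.LinearAlgebra.RootSystem

namespace Base

variable {ι K M N : Type*} [Field K] [CharZero K] [AddCommGroup M] [Module K M]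
  [AddCommGroup N] [Module K N] [Fintype ι]
  {P : RootPairing ι K M N} [P.IsCrystallographic] [P.IsReduced] (b : P.Base)

omit [CharZero K] [Fintype ι] [P.IsCrystallographic] [P.IsReduced] in
/-- `α_{-i} = -α_i` for Mathlib's negation of indices `indexNeg`. [folklore] -/
private theorem root_indexNeg_eq_neg' (i : ι) : letI := P.indexNeg; P.root (-i) = -P.root i := by
  change P.root (P.reflectionPerm i i) = _
  rw [RootPairing.root_reflectionPerm, RootPairing.reflection_apply_self]

omit [CharZero K] [Fintype ι] [P.IsCrystallographic] [P.IsReduced] in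
/-- `α_m = α_k + α_l ⟹ α_{-m} = α_{-k} + α_{-l}`. [folklore] -/
private theorem root_neg_eq_add {k l m : ι} (h : P.root m = P.root k + P.root l) :
    letI := P.indexNeg; P.root (-m) = P.root (-k) + P.root (-l) := by
  rw [root_indexNeg_eq_neg', root_indexNeg_eq_neg', root_indexNeg_eq_neg', h, neg_add]

omit [Fintype ι] [P.IsCrystallographic] [P.IsReduced] in
/-- `wα ≺ 0 ⟺ w(-α) ≻ 0` for an automorphism `w`. [folklore] -/
private theorem not_isPos_smul_iff (w : P.Aut) (k : ι) :
    letI := P.indexNeg; ¬ b.IsPos (w • k) ↔ b.IsPos (w • (-k)) := by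
  letI := P.indexNeg
  rw [smul_index_eq w (-k), indexEquiv_neg, ← smul_index_eq, RootPairing.Base.IsPos.neg_iff_not]

/-! ## §1 `N(w)` and `Φ⁺ ∖ N(w)` are closed -/

section Closed

omit [Fintype ι] [P.IsCrystallographic] [P.IsReduced] in
/-- ★ **THE INVERSION SET `N(w) = {α ≻ 0 : wα ≺ 0}` IS CLOSED**: if `α, β ∈ N(w)` and `α + β` is a root, it lies in `N(w)` (`α + β ≻ 0`, and
`w(α + β) = wα + wβ ≺ 0`); `w` may be any automorphism of `P`. [cite: SommersTymoczko2006, §4 ("N(w) := {α ∈ Φ⁺ | w(α) ≺ 0} is Φ⁺-closed")]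
[cite: Kostant1961, Proposition 5.10] -/
theorem isPos_and_not_isPos_smul_of_root_eq_add (w : P.Aut) {k l m : ι} (hk : b.IsPos k ∧ ¬ b.IsPos (w • k))
    (hl : b.IsPos l ∧ ¬ b.IsPos (w • l)) (h : P.root m = P.root k + P.root l) : b.IsPos m ∧ ¬ b.IsPos (w • m) := by
  letI := P.indexNeg
  refine ⟨hk.1.add hl.1 h, ?_⟩
  rw [not_isPos_smul_iff] at hk hl ⊢
  exact isPos_smul_of_root_eq_add b w hk.2 hl.2 (root_neg_eq_add h)

omit [Fintype ι] [P.IsCrystallographic] [P.IsReduced] in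
/-- ★ **THE COMPLEMENT `Φ⁺ ∖ N(w) = {α ≻ 0 : wα ≻ 0}` IS CLOSED** (an intersection of two positive systems). [cite: SommersTymoczko2006, §4 ("both S
and its complement S^c are closed … if w ∈ W, then N(w) is [of Weyl-type]")] [cite: Kostant1961, Proposition 5.10] -/
theorem isPos_and_isPos_smul_of_root_eq_add (w : P.Aut) {k l m : ι} (hk : b.IsPos k ∧ b.IsPos (w • k))
    (hl : b.IsPos l ∧ b.IsPos (w • l)) (h : P.root m = P.root k + P.root l) : b.IsPos m ∧ b.IsPos (w • m) :=
  ⟨hk.1.add hl.1 h, isPos_smul_of_root_eq_add b w hk.2 hl.2 h⟩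

end Closed

/-! ## §2 Kostant: a subset of `Φ⁺` which is closed with closed complement is `N(w)` for a unique `w ∈ W` -/

section Kostant

/-- ★★★ **KOSTANT'S CHARACTERISATION OF INVERSION SETS (existence)**: let `B ⊆ Φ⁺` be such that `B` and `Φ⁺ ∖ B` are closed. Then `B = N(w)`
for some `w ∈ W`. Proof: `Ψ = (Φ⁺ ∖ B) ∪ (-B)` is closed (four cases, each by closedness of `B` or of `Φ⁺ ∖ B`) and `Φ = Ψ ⊔ -Ψ`, so `Ψ` is a
positive system `u(Φ⁺)`, `u ∈ W` (g40-#8 `exists_weylGroup_forall_smul_mem_iff_isPos`), and then `B = Φ⁺ ∖ Ψ = N(u⁻¹)`. [cite: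
SommersTymoczko2006, §4 ("Conversely every subset of Φ⁺ which is Φ⁺-closed [of Weyl-type] is equal to N(w) for a unique w ∈ W. This is well-known
and goes back to [Kostant]")] [cite: Kostant1961, Proposition 5.10] -/
theorem exists_weylGroup_forall_mem_iff_isPos_and_not_isPos_smul {B : Set ι} (hB : ∀ k ∈ B, b.IsPos k)
    (hcl : ∀ ⦃k l m : ι⦄, k ∈ B → l ∈ B → P.root m = P.root k + P.root l → m ∈ B)
    (hco : ∀ ⦃k l m : ι⦄, b.IsPos k → k ∉ B → b.IsPos l → l ∉ B → P.root m = P.root k + P.root l → m ∉ B) :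
    ∃ w ∈ P.weylGroup, ∀ k, k ∈ B ↔ b.IsPos k ∧ ¬ b.IsPos (w • k) := by
  letI := P.indexNeg
  set Ψ : Set ι := {k | (b.IsPos k ∧ k ∉ B) ∨ -k ∈ B} with hΨdef
  -- a mixed sum: `α_k ∈ Φ⁺ ∖ B`, `α_{-l} ∈ B`, `α_m = α_k + α_l` ⟹ `m ∈ Ψ`
  have hmixed : ∀ ⦃k l m : ι⦄, b.IsPos k → k ∉ B → -l ∈ B → P.root m = P.root k + P.root l → m ∈ Ψ := by
    intro k l m hk hkB hlB h
    by_cases hm : b.IsPos m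
    · -- `α_k = α_m + α_{-l}` with `m, -l`: if `m ∈ B` then `k ∈ B`
      refine Or.inl ⟨hm, fun hmB ↦ hkB (hcl hmB hlB ?_)⟩
      rw [root_indexNeg_eq_neg', h, add_neg_cancel_right]
    · -- `α_{-l} = α_{-m} + α_k` with `-m, k ∈ Φ⁺`: if `-m ∉ B` then `-l ∉ B`
      refine Or.inr ?_
      by_contra hmB
      have hnm : b.IsPos (-m) := (RootPairing.Base.IsPos.neg_iff_not b m).mpr hm
      refine hco hnm hmB hk hkB ?_ hlB
      rw [root_indexNeg_eq_neg', root_indexNeg_eq_neg', h]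
      abel
  have hΨ : ∀ ⦃k l m : ι⦄, k ∈ Ψ → l ∈ Ψ → P.root m = P.root k + P.root l → m ∈ Ψ := by
    rintro k l m (⟨hk, hkB⟩ | hkB) (⟨hl, hlB⟩ | hlB) h
    · exact Or.inl ⟨hk.add hl h, hco hk hkB hl hlB h⟩
    · exact hmixed hk hkB hlB h
    · exact hmixed hl hlB hkB (by rw [h, add_comm])
    · exact Or.inr (hcl hkB hlB (root_neg_eq_add h))
  have hpar : ∀ k, k ∈ Ψ ∨ -k ∈ Ψ := by
    intro k
    by_cases hk : b.IsPos k
    · by_cases hkB : k ∈ B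
      · exact Or.inr (Or.inr (by rw [neg_neg]; exact hkB))
      · exact Or.inl (Or.inl ⟨hk, hkB⟩)
    · have hnk : b.IsPos (-k) := (RootPairing.Base.IsPos.neg_iff_not b k).mpr hk
      by_cases hkB : -k ∈ B
      · exact Or.inl (Or.inr hkB)
      · exact Or.inr (Or.inl ⟨hnk, hkB⟩)
  have hdisj : ∀ ⦃k : ι⦄, k ∈ Ψ → -k ∉ Ψ := by
    rintro k (⟨hk, hkB⟩ | hkB) (⟨hnk, hnkB⟩ | hnkB)
    · exact (RootPairing.Base.IsPos.neg_iff_not b k).mp hnk hk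
    · exact hkB (by rw [neg_neg] at hnkB; exact hnkB)
    · exact hnkB hkB
    · rw [neg_neg] at hnkB
      exact (RootPairing.Base.IsPos.neg_iff_not b k).mp (hB _ hkB) (hB _ hnkB)
  obtain ⟨w, hw, hiff⟩ := exists_weylGroup_forall_smul_mem_iff_isPos b hΨ hpar hdisj
  -- `Ψ = {k : w⁻¹k ≻ 0}`; then `B = N(w⁻¹)`
  have hΨiff : ∀ k, k ∈ Ψ ↔ b.IsPos (w⁻¹ • k) := fun k ↦ by rw [← hiff (w⁻¹ • k), smul_inv_smul]
  refine ⟨w⁻¹, inv_mem hw, fun k ↦ ⟨fun hkB ↦ ⟨hB k hkB, ?_⟩, fun ⟨hk, hwk⟩ ↦ ?_⟩⟩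
  · rw [not_isPos_smul_iff, ← hΨiff]
    exact Or.inr (by rw [neg_neg]; exact hkB)
  · by_contra hkB
    exact hwk ((hΨiff k).mp (Or.inl ⟨hk, hkB⟩))

/-- ★★ **… FOR A UNIQUE `w ∈ W`** (an element of `W` is determined by its inversion set, tree `eq_of_forall_isPos_smul_iff`). [cite:
SommersTymoczko2006, §4 ("is equal to N(w) for a unique w ∈ W")] [cite: Kostant1961, Proposition 5.10] -/
theorem existsUnique_weylGroup_forall_mem_iff_isPos_and_not_isPos_smul {B : Set ι} (hB : ∀ k ∈ B, b.IsPos k)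
    (hcl : ∀ ⦃k l m : ι⦄, k ∈ B → l ∈ B → P.root m = P.root k + P.root l → m ∈ B)
    (hco : ∀ ⦃k l m : ι⦄, b.IsPos k → k ∉ B → b.IsPos l → l ∉ B → P.root m = P.root k + P.root l → m ∉ B) :
    ∃! w : P.weylGroup, ∀ k, k ∈ B ↔ b.IsPos k ∧ ¬ b.IsPos ((w : P.Aut) • k) := by
  obtain ⟨w, hw, hwB⟩ := exists_weylGroup_forall_mem_iff_isPos_and_not_isPos_smul b hB hcl hco
  refine ⟨⟨w, hw⟩, hwB, fun w' hw'B ↦ Subtype.ext ?_⟩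
  refine eq_of_forall_isPos_smul_iff b w'.2 hw fun i hi ↦ ?_
  have h1 := (hw'B i).symm.trans (hwB i)
  constructor
  · intro h'
    by_contra h
    exact (h1.mpr ⟨hi, h⟩).2 h'
  · intro h
    by_contra h'
    exact (h1.mp ⟨hi, h'⟩).2 h

end Kostant

/-! ## §3 Sommers–Tymoczko Lemma 5.1: `N(yx) = N(x) ⊔ x⁻¹N(y)` iff `N(x) ⊆ N(yx)` iff `x⁻¹N(y) ⊆ Φ⁺` iff `n(yx) = n(y) + n(x)` -/

section Lemma51

omit [Fintype ι] [P.IsCrystallographic] [P.IsReduced] in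
/-- ★ **«IT IS EASY TO CHECK FROM THE DEFINITIONS THAT `N(yx) ⊆ N(x) ∪ x⁻¹N(y)`»** (a disjoint union: `xα ≺ 0` on the first part, `xα ≻ 0` on the
second). [cite: SommersTymoczko2006, Lemma 5.1, proof] -/
theorem isPos_and_not_isPos_mul_smul_imp (x y : P.Aut) {k : ι} (hk : b.IsPos k ∧ ¬ b.IsPos ((y * x) • k)) :
    (b.IsPos k ∧ ¬ b.IsPos (x • k)) ∨ (b.IsPos (x • k) ∧ ¬ b.IsPos (y • (x • k))) := by
  by_cases hx : b.IsPos (x • k)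
  · exact Or.inr ⟨hx, by rw [← mul_smul]; exact hk.2⟩
  · exact Or.inl ⟨hk.1, hx⟩

omit [Fintype ι] [P.IsCrystallographic] [P.IsReduced] in
/-- ★★ **LEMMA 5.1 (i) ⟹ (ii): IF `N(x) ⊆ N(yx)` THEN `x⁻¹N(y) ⊆ Φ⁺`** — «`α ∈ x⁻¹N(y)` with `α ≺ 0` if and only if `-α ∈ N(x)` and
`-α ∉ N(yx)`». [cite: SommersTymoczko2006, Lemma 5.1 ((i) ⟹ (ii))] -/
theorem isPos_of_forall_not_isPos_mul_smul (x y : P.Aut)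
    (h : ∀ k, b.IsPos k → ¬ b.IsPos (x • k) → ¬ b.IsPos ((y * x) • k)) {k : ι} (hxk : b.IsPos (x • k))
    (hyxk : ¬ b.IsPos (y • (x • k))) : b.IsPos k := by
  letI := P.indexNeg
  by_contra hk
  have hnk : b.IsPos (-k) := (RootPairing.Base.IsPos.neg_iff_not b k).mpr hk
  have hxnk : ¬ b.IsPos (x • (-k)) := by
    rw [not_isPos_smul_iff, neg_neg]
    exact hxk
  have h1 := h (-k) hnk hxnk
  rw [not_isPos_smul_iff, neg_neg, mul_smul] at h1
  exact hyxk h1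

omit [Fintype ι] [P.IsCrystallographic] [P.IsReduced] in
/-- ★★ **LEMMA 5.1 (ii) ⟹ (iii): IF `x⁻¹N(y) ⊆ Φ⁺` THEN `N(yx) = N(x) ∪ x⁻¹N(y)`** — for `⊇`: an `α ∈ N(x)` with `yxα ≻ 0` would put
`-α = x⁻¹(-xα)` in `x⁻¹N(y) ⊆ Φ⁺`; and «it is clear that `x⁻¹N(y) ∩ Φ⁺ ⊆ N(yx)`». [cite: SommersTymoczko2006, Lemma 5.1 ((ii) ⟹ (iii))] -/
theorem isPos_and_not_isPos_mul_smul_iff_of_forall_isPos (x y : P.Aut)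
    (h : ∀ k, b.IsPos (x • k) → ¬ b.IsPos (y • (x • k)) → b.IsPos k) (k : ι) :
    (b.IsPos k ∧ ¬ b.IsPos ((y * x) • k)) ↔
      (b.IsPos k ∧ ¬ b.IsPos (x • k)) ∨ (b.IsPos (x • k) ∧ ¬ b.IsPos (y • (x • k))) := by
  letI := P.indexNeg
  refine ⟨isPos_and_not_isPos_mul_smul_imp b x y, ?_⟩
  rintro (⟨hk, hxk⟩ | ⟨hxk, hyxk⟩)
  · refine ⟨hk, fun hyxk ↦ ?_⟩
    -- `-xα ∈ N(y)` and `x⁻¹(-xα) = -α ≺ 0`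
    have h1 : b.IsPos (x • (-k)) := (not_isPos_smul_iff b x k).mp hxk
    have h2 : ¬ b.IsPos (y • (x • (-k))) := by
      rw [← mul_smul, not_isPos_smul_iff, neg_neg]
      exact hyxk
    exact (RootPairing.Base.IsPos.neg_iff_not b k).mp (h (-k) h1 h2) hk
  · exact ⟨h k hxk hyxk, by rw [mul_smul]; exact hyxk⟩

omit [P.IsCrystallographic] [P.IsReduced] in
/-- ★★ **`#x⁻¹N(y) = #N(y)`** (`α ↦ xα` is a bijection of the index set). [cite: SommersTymoczko2006, Lemma 5.1, proof ("|N(x)| + |N(y)| =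
|N(x)| + |x⁻¹N(y)|")] -/
theorem card_filter_isPos_smul_and_not_isPos_smul_eq [DecidablePred b.IsPos] (x y : P.Aut) :
    (Finset.univ.filter (fun l ↦ b.IsPos (x • l) ∧ ¬ b.IsPos (y • (x • l)))).card =
      ((Finset.univ.filter b.IsPos).filter (fun l ↦ ¬ b.IsPos (y • l))).card := by
  refine Finset.card_bij' (fun l _ ↦ x • l) (fun m _ ↦ x⁻¹ • m) ?_ ?_ ?_ ?_
  · intro l hl
    simp only [Finset.mem_filter, Finset.mem_univ, true_and] at hl ⊢
    exact hl
  · intro m hm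
    simp only [Finset.mem_filter, Finset.mem_univ, true_and] at hm ⊢
    rw [smul_inv_smul]
    exact hm
  · intro l _
    rw [inv_smul_smul]
  · intro m _
    rw [smul_inv_smul]

omit [Fintype ι] [P.IsCrystallographic] [P.IsReduced] in
/-- Finite bookkeeping for Lemma 5.1: if `C ⊆ A ∪ B` with `A, B` disjoint, then `C = A ∪ B` (pointwise) iff `#C = #A + #B`. [folklore] -/
private theorem forall_mem_iff_iff_card_eq [DecidableEq ι] {A B C : Finset ι} (hsub : C ⊆ A ∪ B) (hdisj : Disjoint A B) :
    (∀ k, k ∈ C ↔ k ∈ A ∨ k ∈ B) ↔ C.card = A.card + B.card := by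
  constructor
  · intro h
    have heq : C = A ∪ B := by
      ext k
      rw [Finset.mem_union]
      exact h k
    rw [heq, Finset.card_union_of_disjoint hdisj]
  · intro h k
    have heq : C = A ∪ B :=
      Finset.eq_of_subset_of_card_le hsub (by rw [Finset.card_union_of_disjoint hdisj, h])
    rw [heq, Finset.mem_union]

omit [P.IsCrystallographic] [P.IsReduced] in
/-- ★★ **«`l(yx) ≤ l(x) + l(y)`», i.e. `#N(yx) ≤ #N(y) + #N(x)`** for ARBITRARY automorphisms `x, y` (`N(yx) ⊆ N(x) ∪ x⁻¹N(y)` and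
`#x⁻¹N(y) = #N(y)`; for `x, y ∈ W` this is the tree's `card_filter_mul_le_add` of `WeylGroupSignCharacter`, proved there through Coxeter lengths).
[cite: SommersTymoczko2006, Lemma 5.1, proof ("|N(yx)| ≤ |N(x)| + |N(y)|")] -/
theorem card_filter_mul_le_add_aut [DecidableEq ι] [DecidablePred b.IsPos] (x y : P.Aut) :
    ((Finset.univ.filter b.IsPos).filter (fun l ↦ ¬ b.IsPos ((y * x) • l))).card ≤
      ((Finset.univ.filter b.IsPos).filter (fun l ↦ ¬ b.IsPos (y • l))).card +
        ((Finset.univ.filter b.IsPos).filter (fun l ↦ ¬ b.IsPos (x • l))).card := by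
  rw [← card_filter_isPos_smul_and_not_isPos_smul_eq b x y, add_comm]
  calc ((Finset.univ.filter b.IsPos).filter (fun l ↦ ¬ b.IsPos ((y * x) • l))).card
      ≤ ((Finset.univ.filter b.IsPos).filter (fun l ↦ ¬ b.IsPos (x • l)) ∪
          Finset.univ.filter (fun l ↦ b.IsPos (x • l) ∧ ¬ b.IsPos (y • (x • l)))).card := by
        refine Finset.card_le_card fun k hk ↦ ?_
        rw [Finset.mem_union]
        simp only [Finset.mem_filter, Finset.mem_univ, true_and] at hk ⊢
        exact isPos_and_not_isPos_mul_smul_imp b x y hk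
    _ ≤ _ := Finset.card_union_le _ _

omit [P.IsCrystallographic] [P.IsReduced] in
/-- ★★★ **SOMMERS–TYMOCZKO LEMMA 5.1: «Let `x, y ∈ W`. Then the following four conditions are equivalent: (i) `N(x) ⊆ N(yx)` (ii)
`x⁻¹N(y) ⊆ Φ⁺` (iii) `N(yx) = N(x) ∪ x⁻¹N(y)` (iv) `l(yx) = l(y) + l(x)`»** — here for arbitrary automorphisms `x, y` of `P`, with `l` the number
`n(·) = #N(·)` of positive roots made negative (the length on `W`). (iii) ⟺ (iv): `N(yx) ⊆ N(x) ⊔ x⁻¹N(y)` always, with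
`#(N(x) ⊔ x⁻¹N(y)) = n(x) + n(y)`. [cite: SommersTymoczko2006, Lemma 5.1] -/
theorem tfae_inversionSet_mul [DecidableEq ι] [DecidablePred b.IsPos] (x y : P.Aut) :
    List.TFAE [
      ∀ k, b.IsPos k → ¬ b.IsPos (x • k) → ¬ b.IsPos ((y * x) • k),
      ∀ k, b.IsPos (x • k) → ¬ b.IsPos (y • (x • k)) → b.IsPos k,
      ∀ k, (b.IsPos k ∧ ¬ b.IsPos ((y * x) • k)) ↔
        (b.IsPos k ∧ ¬ b.IsPos (x • k)) ∨ (b.IsPos (x • k) ∧ ¬ b.IsPos (y • (x • k))),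
      ((Finset.univ.filter b.IsPos).filter (fun l ↦ ¬ b.IsPos ((y * x) • l))).card =
        ((Finset.univ.filter b.IsPos).filter (fun l ↦ ¬ b.IsPos (y • l))).card +
          ((Finset.univ.filter b.IsPos).filter (fun l ↦ ¬ b.IsPos (x • l))).card] := by
  -- the finsets `N(yx) ⊆ N(x) ⊔ x⁻¹N(y)`
  have hdisj : Disjoint ((Finset.univ.filter b.IsPos).filter (fun l ↦ ¬ b.IsPos (x • l)))
      (Finset.univ.filter (fun l ↦ b.IsPos (x • l) ∧ ¬ b.IsPos (y • (x • l)))) := by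
    rw [Finset.disjoint_left]
    intro k hk hk'
    simp only [Finset.mem_filter, Finset.mem_univ, true_and] at hk hk'
    exact hk.2 hk'.1
  have hsub : (Finset.univ.filter b.IsPos).filter (fun l ↦ ¬ b.IsPos ((y * x) • l)) ⊆
      (Finset.univ.filter b.IsPos).filter (fun l ↦ ¬ b.IsPos (x • l)) ∪
        Finset.univ.filter (fun l ↦ b.IsPos (x • l) ∧ ¬ b.IsPos (y • (x • l))) := by
    intro k hk
    rw [Finset.mem_union]
    simp only [Finset.mem_filter, Finset.mem_univ, true_and] at hk ⊢
    exact isPos_and_not_isPos_mul_smul_imp b x y hk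
  -- (iii) ⟺ (iv) by counting
  have h34 : (∀ k, (b.IsPos k ∧ ¬ b.IsPos ((y * x) • k)) ↔
      (b.IsPos k ∧ ¬ b.IsPos (x • k)) ∨ (b.IsPos (x • k) ∧ ¬ b.IsPos (y • (x • k)))) ↔
      ((Finset.univ.filter b.IsPos).filter (fun l ↦ ¬ b.IsPos ((y * x) • l))).card =
        ((Finset.univ.filter b.IsPos).filter (fun l ↦ ¬ b.IsPos (y • l))).card +
          ((Finset.univ.filter b.IsPos).filter (fun l ↦ ¬ b.IsPos (x • l))).card := by
    rw [← card_filter_isPos_smul_and_not_isPos_smul_eq b x y, add_comm, ← forall_mem_iff_iff_card_eq hsub hdisj]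
    simp only [Finset.mem_filter, Finset.mem_univ, true_and]
  tfae_have 1 → 2 := fun h k ↦ isPos_of_forall_not_isPos_mul_smul b x y h
  tfae_have 2 → 3 := fun h k ↦ isPos_and_not_isPos_mul_smul_iff_of_forall_isPos b x y h k
  tfae_have 3 → 1 := fun h k hk hxk ↦ ((h k).mpr (Or.inl ⟨hk, hxk⟩)).2
  tfae_have 3 ↔ 4 := h34
  tfae_finish

omit [P.IsCrystallographic] [P.IsReduced] in
/-- ★★ **`n(yx) = n(y) + n(x)` IFF `N(x) ⊆ N(yx)`** ((iv) ⟺ (i) of Lemma 5.1, extracted). [cite: SommersTymoczko2006, Lemma 5.1 ((i) ⟺ (iv))] -/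
theorem card_filter_mul_eq_add_iff [DecidableEq ι] [DecidablePred b.IsPos] (x y : P.Aut) :
    ((Finset.univ.filter b.IsPos).filter (fun l ↦ ¬ b.IsPos ((y * x) • l))).card =
        ((Finset.univ.filter b.IsPos).filter (fun l ↦ ¬ b.IsPos (y • l))).card +
          ((Finset.univ.filter b.IsPos).filter (fun l ↦ ¬ b.IsPos (x • l))).card ↔
      ∀ k, b.IsPos k → ¬ b.IsPos (x • k) → ¬ b.IsPos ((y * x) • k) :=
  (tfae_inversionSet_mul b x y).out 3 0

end Lemma51

/-! ## §4 Corollary 5.2: between `N(x) ⊊ N(w)` one can insert `N(s_α x)` and `N(s_β w)` with `α, β` simple -/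

section Corollary52

/-- ★ **`N(s_j) = {α_j}` FOR A SIMPLE ROOT `α_j`**: `s_j` permutes `Φ⁺ ∖ {α_j}` and `s_jα_j = -α_j`. [cite: SommersTymoczko2006, §4–§5 (l(w) =
|N(w)|)] [cite: Humphreys1990, §1.4 Proposition ("s_α permutes the positive roots other than α")] -/
theorem isPos_and_not_isPos_reflection_smul_iff {j : ι} (hj : j ∈ b.support) (k : ι) :
    (b.IsPos k ∧ ¬ b.IsPos (RootPairing.Equiv.reflection P j • k)) ↔ k = j := by
  letI := P.indexNeg
  constructor
  · rintro ⟨hk, hsk⟩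
    by_contra hkj
    exact hsk (by rw [reflection_smul_index]; exact hk.reflectionPerm hj hkj)
  · rintro rfl
    refine ⟨RootPairing.Base.isPos_of_mem_support hj, ?_⟩
    rw [reflection_smul_index, show P.reflectionPerm k k = -k from rfl, RootPairing.Base.IsPos.neg_iff_not, not_not]
    exact RootPairing.Base.isPos_of_mem_support hj

/-- ★★★ **COROLLARY 5.2, FIRST HALF: IF `N(x) ⊊ N(w)` (`x, w ∈ W`) THERE IS A SIMPLE `α` WITH `N(x) ⊊ N(s_α x) ⊆ N(w)`** — with `y = wx⁻¹`
(so `w = yx` and, by Lemma 5.1, `N(w) = N(x) ⊔ x⁻¹N(y)`): `y ≠ 1` has a simple root `α ∈ N(y)`, and `N(s_α x) = N(x) ⊔ {x⁻¹α}` (Lemma 5.1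
for the pair `(x, s_α)`, `N(s_α) = {α}`, `x⁻¹α ≻ 0`). Recorded as: `x⁻¹α ≻ 0`, `x⁻¹α ∉ N(x)`, `x⁻¹α ∈ N(w)`, and
`N(s_α x) = N(x) ∪ {x⁻¹α} ⊆ N(w)`. [cite: SommersTymoczko2006, Corollary 5.2] -/
theorem exists_mem_support_ssubset_of_ssubset {x w : P.Aut} (hx : x ∈ P.weylGroup) (hw : w ∈ P.weylGroup)
    (hsub : ∀ k, b.IsPos k → ¬ b.IsPos (x • k) → ¬ b.IsPos (w • k))
    (hne : ∃ k, b.IsPos k ∧ ¬ b.IsPos (w • k) ∧ b.IsPos (x • k)) :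
    ∃ j ∈ b.support, b.IsPos (x⁻¹ • j) ∧ b.IsPos (x • (x⁻¹ • j)) ∧ ¬ b.IsPos (w • (x⁻¹ • j)) ∧
      (∀ k, (b.IsPos k ∧ ¬ b.IsPos ((RootPairing.Equiv.reflection P j * x) • k)) ↔
        (b.IsPos k ∧ ¬ b.IsPos (x • k)) ∨ k = x⁻¹ • j) ∧
      (∀ k, b.IsPos k → ¬ b.IsPos ((RootPairing.Equiv.reflection P j * x) • k) → ¬ b.IsPos (w • k)) := by
  letI := P.indexNeg
  -- `y = w x⁻¹`, `w = y x`
  set y := w * x⁻¹ with hy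
  have hwyx : w = y * x := by rw [hy, inv_mul_cancel_right]
  have hyW : y ∈ P.weylGroup := mul_mem hw (inv_mem hx)
  clear_value y
  -- Lemma 5.1 (i) ⟹ (ii), (iii) for `(x, y)`
  have hi : ∀ k, b.IsPos k → ¬ b.IsPos (x • k) → ¬ b.IsPos ((y * x) • k) := by
    intro k hk hxk; rw [← hwyx]; exact hsub k hk hxk
  have hii : ∀ k, b.IsPos (x • k) → ¬ b.IsPos (y • (x • k)) → b.IsPos k := fun k ↦
    isPos_of_forall_not_isPos_mul_smul b x y hi
  -- `y ≠ 1`, so some simple `α_j ∈ N(y)`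
  have hy1 : y ≠ 1 := by
    rintro h1
    obtain ⟨k, hk, hwk, hxk⟩ := hne
    rw [hwyx, h1, one_mul] at hwk
    exact hwk hxk
  obtain ⟨j, hj, hyj⟩ : ∃ j ∈ b.support, ¬ b.IsPos (y • j) := by
    by_contra h
    push Not at h
    exact hy1 (eq_one_of_forall_isPos_smul b hyW h)
  have hxj : b.IsPos (x • (x⁻¹ • j)) := by rw [smul_inv_smul]; exact RootPairing.Base.isPos_of_mem_support hj
  have hyxj : ¬ b.IsPos (y • (x • (x⁻¹ • j))) := by rw [smul_inv_smul]; exact hyj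
  have hpos : b.IsPos (x⁻¹ • j) := hii _ hxj hyxj
  have hwj : ¬ b.IsPos (w • (x⁻¹ • j)) := by rw [hwyx, mul_smul]; exact hyxj
  -- `N(s_j x) = N(x) ∪ {x⁻¹ j}` by Lemma 5.1 for `(x, s_j)`
  have hii' : ∀ k, b.IsPos (x • k) → ¬ b.IsPos (RootPairing.Equiv.reflection P j • (x • k)) → b.IsPos k := by
    intro k hxk hsk
    have hkj : x • k = j := (isPos_and_not_isPos_reflection_smul_iff b hj (x • k)).mp ⟨hxk, hsk⟩
    rw [← hkj, inv_smul_smul] at hpos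
    exact hpos
  have hiii := isPos_and_not_isPos_mul_smul_iff_of_forall_isPos b x (RootPairing.Equiv.reflection P j) hii'
  refine ⟨j, hj, hpos, hxj, hwj, fun k ↦ ?_, fun k hk hsk ↦ ?_⟩
  · rw [hiii k, isPos_and_not_isPos_reflection_smul_iff b hj (x • k)]
    constructor
    · rintro (h | h)
      · exact Or.inl h
      · exact Or.inr (by rw [← h, inv_smul_smul])
    · rintro (h | rfl)
      · exact Or.inl h
      · exact Or.inr (smul_inv_smul x j)
  · rcases (hiii k).mp ⟨hk, hsk⟩ with ⟨hk', hxk⟩ | ⟨hxk, hsk'⟩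
    · exact hsub k hk' hxk
    · have hkj : x • k = j := (isPos_and_not_isPos_reflection_smul_iff b hj (x • k)).mp ⟨hxk, hsk'⟩
      have hk' : k = x⁻¹ • j := by rw [← hkj, inv_smul_smul]
      rw [hk']
      exact hwj

/-- ★★★ **COROLLARY 5.2, SECOND HALF: IF `N(x) ⊊ N(w)` (`x, w ∈ W`) THERE IS A SIMPLE `β` WITH `N(x) ⊆ N(s_β w) ⊊ N(w)`** — with `y = wx⁻¹`:
`y⁻¹ ≠ 1` has a simple `β` with `y⁻¹β ≺ 0`; then `N(s_β y) = N(y) ∖ {-y⁻¹β}` (Lemma 5.1 for `(s_β y, s_β)`), so `x⁻¹N(s_β y) ⊆ x⁻¹N(y) ⊆ Φ⁺`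
and `N(s_β w) = N(x) ⊔ x⁻¹N(s_β y) ⊆ N(w)`, missing the root `x⁻¹(-y⁻¹β) = -w⁻¹β` of `N(w)`. Recorded as: `N(x) ⊆ N(s_β w) ⊆ N(w)`, and
`-w⁻¹β ∈ N(w) ∖ N(s_β w)`. [cite: SommersTymoczko2006, Corollary 5.2] -/
theorem exists_mem_support_ssubset_of_ssubset' {x w : P.Aut} (hx : x ∈ P.weylGroup) (hw : w ∈ P.weylGroup)
    (hsub : ∀ k, b.IsPos k → ¬ b.IsPos (x • k) → ¬ b.IsPos (w • k))
    (hne : ∃ k, b.IsPos k ∧ ¬ b.IsPos (w • k) ∧ b.IsPos (x • k)) :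
    letI := P.indexNeg
    ∃ j ∈ b.support,
      (∀ k, b.IsPos k → ¬ b.IsPos (x • k) → ¬ b.IsPos ((RootPairing.Equiv.reflection P j * w) • k)) ∧
      (∀ k, b.IsPos k → ¬ b.IsPos ((RootPairing.Equiv.reflection P j * w) • k) → ¬ b.IsPos (w • k)) ∧
      (b.IsPos (w⁻¹ • (-j)) ∧ ¬ b.IsPos (w • (w⁻¹ • (-j))) ∧
        b.IsPos ((RootPairing.Equiv.reflection P j * w) • (w⁻¹ • (-j)))) := by
  letI := P.indexNeg
  set y := w * x⁻¹ with hy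
  have hwyx : w = y * x := by rw [hy, inv_mul_cancel_right]
  have hyW : y ∈ P.weylGroup := mul_mem hw (inv_mem hx)
  clear_value y
  have hi : ∀ k, b.IsPos k → ¬ b.IsPos (x • k) → ¬ b.IsPos ((y * x) • k) := by
    intro k hk hxk; rw [← hwyx]; exact hsub k hk hxk
  have hii : ∀ k, b.IsPos (x • k) → ¬ b.IsPos (y • (x • k)) → b.IsPos k := fun k ↦
    isPos_of_forall_not_isPos_mul_smul b x y hi
  have hiii := isPos_and_not_isPos_mul_smul_iff_of_forall_isPos b x y hii
  -- `y⁻¹ ≠ 1`: a simple `α_j` with `y⁻¹α_j ≺ 0`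
  have hy1 : y⁻¹ ≠ 1 := by
    rintro h1
    rw [inv_eq_one] at h1
    obtain ⟨k, hk, hwk, hxk⟩ := hne
    rw [hwyx, h1, one_mul] at hwk
    exact hwk hxk
  obtain ⟨j, hj, hyj⟩ : ∃ j ∈ b.support, ¬ b.IsPos (y⁻¹ • j) := by
    by_contra h
    push Not at h
    exact hy1 (eq_one_of_forall_isPos_smul b (inv_mem hyW) h)
  set s := RootPairing.Equiv.reflection P j with hs
  have hsj : s • j = -j := by rw [hs, reflection_smul_index]; rfl
  have hss : s * s = 1 := by
    rw [hs]
    nth_rewrite 1 [← RootPairing.Equiv.reflection_inv P j]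
    exact inv_mul_cancel _
  -- Lemma 5.1 for `(s y, s)`: `(s y)⁻¹ N(s) = {y⁻¹ s j} = {-y⁻¹ j} ⊆ Φ⁺`, so `N(y) = N(s y) ⊔ {-y⁻¹ j}` and `N(s y) ⊆ N(y)`
  have hii_sy : ∀ k, b.IsPos ((s * y) • k) → ¬ b.IsPos (s • ((s * y) • k)) → b.IsPos k := by
    intro k hk hsk
    have hkj : (s * y) • k = j := (isPos_and_not_isPos_reflection_smul_iff b hj _).mp ⟨hk, hsk⟩
    have hk' : k = y⁻¹ • (-j) := by
      have : y • k = s • j := by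
        rw [← hkj, mul_smul, ← mul_smul s s, hss, one_smul]
      rw [hsj] at this
      rw [← this, inv_smul_smul]
    rw [hk', smul_index_eq y⁻¹, indexEquiv_neg, ← smul_index_eq, RootPairing.Base.IsPos.neg_iff_not]
    exact hyj
  have hiii_sy := isPos_and_not_isPos_mul_smul_iff_of_forall_isPos b (s * y) s hii_sy
  have hsy_sub : ∀ k, b.IsPos k → ¬ b.IsPos ((s * y) • k) → ¬ b.IsPos (y • k) := by
    intro k hk hsyk
    have h1 := (hiii_sy k).mpr (Or.inl ⟨hk, hsyk⟩)
    rw [← mul_assoc, hss, one_mul] at h1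
    exact h1.2
  -- Lemma 5.1 for `(x, s y)`: (ii) holds since `x⁻¹N(s y) ⊆ x⁻¹N(y) ⊆ Φ⁺`
  have hii' : ∀ k, b.IsPos (x • k) → ¬ b.IsPos ((s * y) • (x • k)) → b.IsPos k := fun k hxk hsyxk ↦
    hii k hxk (hsy_sub _ hxk hsyxk)
  have hiii' := isPos_and_not_isPos_mul_smul_iff_of_forall_isPos b x (s * y) hii'
  have hsw : s * w = s * y * x := by rw [hwyx, mul_assoc]
  refine ⟨j, hj, fun k hk hxk ↦ ?_, fun k hk hswk ↦ ?_, ?_, ?_, ?_⟩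
  · rw [hsw]
    exact ((hiii' k).mpr (Or.inl ⟨hk, hxk⟩)).2
  · rw [hsw] at hswk
    rw [hwyx]
    rcases (hiii' k).mp ⟨hk, hswk⟩ with ⟨hk', hxk⟩ | ⟨hxk, hsyxk⟩
    · exact ((hiii k).mpr (Or.inl ⟨hk', hxk⟩)).2
    · exact ((hiii k).mpr (Or.inr ⟨hxk, hsy_sub _ hxk hsyxk⟩)).2
  · -- `-w⁻¹ j = x⁻¹(-y⁻¹ j) ≻ 0`
    have h1 : b.IsPos (x • (w⁻¹ • (-j))) := by
      rw [hwyx, mul_inv_rev, mul_smul, smul_inv_smul, smul_index_eq y⁻¹, indexEquiv_neg, ← smul_index_eq,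
        RootPairing.Base.IsPos.neg_iff_not]
      exact hyj
    have h2 : ¬ b.IsPos (y • (x • (w⁻¹ • (-j)))) := by
      rw [← mul_smul, ← hwyx, smul_inv_smul, RootPairing.Base.IsPos.neg_iff_not, not_not]
      exact RootPairing.Base.isPos_of_mem_support hj
    exact hii _ h1 h2
  · rw [smul_inv_smul, RootPairing.Base.IsPos.neg_iff_not, not_not]
    exact RootPairing.Base.isPos_of_mem_support hj
  · rw [mul_smul, smul_inv_smul, smul_index_eq s, indexEquiv_neg, ← smul_index_eq, hsj, neg_neg]
    exact RootPairing.Base.isPos_of_mem_support hj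

end Corollary52

end Base

end Literature.LinearAlgebra.RootSystem
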